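import Literature.NumberTheory.Sieve.MoebiusShiftedPrimesProofs
import Literature.NumberTheory.Sieve.SieveFrameworkUpperBound
import Literature.NumberTheory.Sieve.SieveFrameworkProofs
import Literature.NumberTheory.Sieve.BrunTwinPrimes
import Literature.NumberTheory.LFunctions.MertensTail
import HarnessLib

/-!
# Möbius on shifted primes — the sieve bound (2.5) of Lichtman 2020, proved

Topic `Literature/NumberTheory/Sieve`, companion of `MoebiusShiftedPrimes.lean` (the named fact
`Literature.NumberTheory.Sieve.lichtman2020_moebius_shifted_primes_avg` = J. D. Lichtman, *Averages of the Möbius function on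
shifted primes*, Q. J. Math. (2021), doi:10.1093/qmath/haab054, arXiv:2009.08969 [Lichtman2020],
Theorem 1.1, qualitative part) and of `MoebiusShiftedPrimesProofs.lean` (the top layer of its
decomposition: Theorem 1.1 ⇐ Theorem 2.2 + the sieve bound (2.5)).

This file DISCHARGES the named fact `Literature.NumberTheory.Sieve.Lichtman2020_shiftedPrimeSieveBound` = display (2.5) of
the paper (held copy `paper:arxiv-2009.08969`, p. 7): "By a standard sieve upper bound [Opera], for
each `h ≤ H`, `j = 1, 2` we have `#{p ≤ X : q ∤ p + h ∀ q ∈ [P_j, Q_j]} ≪ π(X) (log P_j/log Q_j) (h/φ(h))`",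
recorded (in `MoebiusShiftedPrimesProofs`) with one absolute constant for all `X`, `h ≥ 1` and
`2 ≤ P ≤ Q ≤ X`.  Consequently Lichtman's Theorem 1.1 (qualitative part) now rests on Theorem 2.2
alone: `lichtman2020_moebius_shifted_primes_avg_of_keyFourierEstimate'`.

## The proof

The "standard sieve upper bound" is taken from the tree: the upper-bound beta sieve of arbitrary
dimension `κ` for a sifted sequence, `Literature.NumberTheory.Sieve.SieveSequence.sifted_le_of_dvd_primesProdBelow`
(`SieveFrameworkUpperBound.lean`, proved there; Friedlander–Iwaniec, *Opera de Cribro*, Thm 6.9 /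
Lemma 6.8): `S(𝒜, P(z)) ≤ (1 + 2K^{10} e^{9κ+1-s}) X V(z) + ∑_{d ∣ P(z), d ≤ D} |R_d|`.

* **The sequence.**  Removing the class `0 (mod q)` for every prime `q < z` and the class
  `-h (mod q)` for the primes `q ∈ [P, Q]` is encoded by sifting the VALUES
  `Φ(n) = n · ∏_{p ∣ n + h, P ≤ p ≤ Q} p` (`Lichtman2020.encode`), `1 ≤ n ≤ X`: a prime `q` divides
  `Φ(n)` iff `n` lies in a removed class modulo `q` (`prime_dvd_encode_iff`).  The sifted sequence
  (`Lichtman2020.seq`) has weights `a_m = #{n ≤ X : Φ(n) = m}`, size `X` and the multiplicative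
  density `g(d) = ∏_{p ∣ d} ω(p)/p`, `ω(p) ∈ {1, 2}` the number of removed classes
  (`Lichtman2020.density`); a prime `p > z - 1` counted in (2.5) survives the sifting
  (`card_filter_primes_le_sifted`).
* **Level.**  For squarefree `d` the condition `d ∣ Φ(n)` is periodic modulo `d` with exactly
  `ω(d) = ∏_{p ∣ d} ω(p)` admissible residues (Chinese remainder theorem,
  `card_filter_range_prod_eq_prod_card`), so `|R_d| ≤ ω(d) ≤ d` (`abs_remainder_le`); with
  `D = z^{19}`, `z = ⌊X^{1/76}⌋ + 1` the remainders contribute `≤ D² ≤ 2^{38} √X`.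
* **Dimension.**  Outside the degenerate case (`P ≤ 2` and `h` odd, where only `p = 2` is counted)
  `ω(2) = 1`, so `0 ≤ g(p) < 1` and, by Mertens' theorem over a window
  (`Literature.NumberTheory.Sieve.sum_primesWindow_one_div_le`) and `(1 - 2/p)⁻¹ ≤ exp(2/p + 8/(p(p-1)))`,
  `∏_{w ≤ p < z} (1 - g(p))⁻¹ ≤ 2e^{17 + 12/log 2} (log z/log w)²`: dimension `κ = 2` with an
  ABSOLUTE constant (`hasSieveDimension_density`).
* **Main term.**  `V(z) = ∏_{p < z} (1 - ω(p)/p) ≤ ∏_{p < z} (1 - 1/p) · ∏_{p ∈ [P, min(Q, z)), p ∤ h} (1 - 1/p)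
  ≪ (1/log z) · (log P/log min(Q, z)) · h/φ(h)` by Mertens' product bounds
  (`Literature.NumberTheory.LFunctions.MertensBound.prod_one_sub_inv_prime_Icc_le`) and `φ(h)/h = ∏_{p ∣ h}(1 - 1/p)`; here
  `log z ≥ log X/152` and `log min(Q, z) ≥ log Q/152`.
* **Assembly.**  `X/log X ≤ 4 π(X)` (Chebyshev, Mathlib's `Chebyshev.pi_ge`) and
  `√X log X ≤ 64 π(X)`, `log 2/log X ≤ log P/log Q` absorb the `≤ z` small primes and the level;
  `X < 2^{152}` is covered by the trivial bound `≤ π(X) ≤ 152 π(X) log P/log Q`.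

All constants are explicit but crude (the final `C` is about `4 (1 + 2K^{10}) 152² e^{12/log 2}` with
`K = 2e^{17+12/log 2}`); only the existence of an absolute constant is asserted, as printed.

## Sources

* J. D. Lichtman, *Averages of the Möbius function on shifted primes*, Q. J. Math. (2021),
  arXiv:2009.08969, display (2.5) (held `paper:arxiv-2009.08969`, p. 7).
* J. Friedlander, H. Iwaniec, *Opera de Cribro*, AMS Colloquium Publ. 57 (2010), Lemma 6.8, Thm 6.9
  (the paper's [Opera]; the tree's `SieveFrameworkUpperBound.lean`).
-/

open Finset

namespace Literature.NumberTheory.Sieve.Lichtman2020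

/-! ### Elementary inequalities -/

/-- `log x ≤ x / e` for `x > 0`. [folklore] -/
theorem log_le_div_exp_one {x : ℝ} (hx : 0 < x) : Real.log x ≤ x / Real.exp 1 := by
  have := Real.log_le_sub_one_of_pos (show 0 < x / Real.exp 1 by positivity)
  rw [Real.log_div hx.ne' (Real.exp_pos 1).ne', Real.log_exp] at this
  linarith

/-- `(log X)² ≤ 16 √X` for `X ≥ 1`.  This is `Literature.NumberTheory.Sieve.SelbergSymmetry.log_sq_le_sqrt`
(`SelbergSymmetryFormula.lean`) verbatim, copied here to avoid importing that file (which pulls in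
`ParityBarrierProofs`); librarian note: hoist both to a shared elementary file. [folklore] -/
theorem log_sq_le_sqrt {X : ℝ} (hX : 1 ≤ X) : Real.log X ^ 2 ≤ 16 * Real.sqrt X := by
  have hX0 : 0 < X := by linarith
  have h4 : Real.log X = 4 * Real.log (X ^ ((1 : ℝ) / 4)) := by
    rw [Real.log_rpow hX0]; ring
  have hr1 : 1 ≤ X ^ ((1 : ℝ) / 4) := Real.one_le_rpow hX (by norm_num)
  have hlog : Real.log (X ^ ((1 : ℝ) / 4)) ≤ X ^ ((1 : ℝ) / 4) - 1 :=
    Real.log_le_sub_one_of_pos (by linarith)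
  have hlog0 : 0 ≤ Real.log (X ^ ((1 : ℝ) / 4)) := Real.log_nonneg hr1
  have hsq : Real.sqrt X = X ^ ((1 : ℝ) / 4) * X ^ ((1 : ℝ) / 4) := by
    rw [Real.sqrt_eq_rpow, ← Real.rpow_add hX0]; norm_num
  rw [h4, hsq]
  nlinarith

/-- Chebyshev: `X / log X ≤ 4 π(X)` for `X ≥ 4`. [folklore] -/
theorem div_log_le_four_mul_primeCounting {X : ℕ} (hX : 4 ≤ X) :
    (X : ℝ) / Real.log X ≤ 4 * Nat.primeCounting X := by
  have hX4 : (4 : ℝ) ≤ X := by exact_mod_cast hX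
  have hX0 : (0 : ℝ) < X := by linarith
  have hlog : 0 < Real.log X := Real.log_pos (by linarith)
  have hπ := Chebyshev.pi_ge X
  rw [div_le_iff₀ hlog] at hπ
  rw [div_le_iff₀ hlog]
  have hl2 : (0.6931471803 : ℝ) < Real.log 2 := Real.log_two_gt_d9
  have he : (2.7182818283 : ℝ) < Real.exp 1 := Real.exp_one_gt_d9
  have h1 : Real.log ((X : ℝ) + 1) ≤ 1 / 4 + X / Real.exp 1 := by
    have hx1 : (X : ℝ) + 1 ≤ 5 / 4 * X := by linarith
    calc Real.log ((X : ℝ) + 1) ≤ Real.log (5 / 4 * X) := Real.log_le_log (by linarith) hx1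
      _ = Real.log (5 / 4) + Real.log X := Real.log_mul (by norm_num) hX0.ne'
      _ ≤ (5 / 4 - 1) + X / Real.exp 1 :=
          add_le_add (Real.log_le_sub_one_of_pos (by norm_num)) (log_le_div_exp_one hX0)
      _ = 1 / 4 + X / Real.exp 1 := by norm_num
  have h2 : (X : ℝ) / Real.exp 1 ≤ 0.3704 * X := by
    rw [div_le_iff₀ (Real.exp_pos 1)]
    nlinarith
  nlinarith

/-- `√X ≤ 64 π(X) / log X` for `X ≥ 4` (from `(log X)² ≤ 16 √X` and Chebyshev). [folklore] -/
theorem sqrt_mul_log_le {X : ℕ} (hX : 4 ≤ X) :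
    Real.sqrt X * Real.log X ≤ 64 * Nat.primeCounting X := by
  have hX4 : (4 : ℝ) ≤ X := by exact_mod_cast hX
  have hX0 : (0 : ℝ) < X := by linarith
  have hlogX : 0 < Real.log X := Real.log_pos (by linarith)
  have h1 : Real.sqrt X * Real.log X ^ 2 ≤ 16 * X := by
    have := log_sq_le_sqrt (show (1 : ℝ) ≤ X by linarith)
    calc Real.sqrt X * Real.log X ^ 2 ≤ Real.sqrt X * (16 * Real.sqrt X) :=
          mul_le_mul_of_nonneg_left this (Real.sqrt_nonneg _)
      _ = 16 * X := by rw [mul_left_comm, Real.mul_self_sqrt hX0.le]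
  have h2 : (X : ℝ) ≤ 4 * Nat.primeCounting X * Real.log X := by
    have := div_log_le_four_mul_primeCounting hX
    rwa [div_le_iff₀ hlogX] at this
  have h3 : Real.sqrt X * Real.log X * Real.log X ≤ 64 * Nat.primeCounting X * Real.log X := by
    nlinarith
  exact le_of_mul_le_mul_right h3 hlogX

/-- Divisibility as a residue condition: for `q > 0`, `q ∣ p + h ↔ p % q = (q - h % q) % q`.
[folklore] -/
theorem dvd_add_iff_mod_eq {q : ℕ} (hq : 0 < q) (p h : ℕ) :
    q ∣ p + h ↔ p % q = (q - h % q) % q := by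
  haveI : NeZero q := ⟨hq.ne'⟩
  rw [← ZMod.natCast_eq_natCast_iff', ← ZMod.natCast_eq_zero_iff]
  have hle : h % q ≤ q := (Nat.mod_lt h hq).le
  push_cast [Nat.cast_sub hle]
  rw [ZMod.natCast_self, ZMod.natCast_mod, zero_sub, ← add_eq_zero_iff_eq_neg]

/-- `φ(h)/h = ∏_{p ∣ h} (1 - 1/p) ≤ ∏_{p ∈ T} (1 - 1/p)` for any set `T` of prime divisors of `h`.
[folklore] -/
theorem totient_div_le_prod {h : ℕ} (hh : h ≠ 0) {T : Finset ℕ} (hT : T ⊆ h.primeFactors) :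
    (Nat.totient h : ℝ) / h ≤ ∏ p ∈ T, (1 - 1 / (p : ℝ)) := by
  classical
  have hh0 : (0 : ℝ) < h := by exact_mod_cast Nat.pos_of_ne_zero hh
  rw [Literature.NumberTheory.LFunctions.MertensBound.totient_eq_mul_prod_one_sub_inv h, mul_div_cancel_left₀ _ hh0.ne']
  refine Finset.prod_le_prod_of_subset_of_le_one hT (fun p hp => ?_) (fun p hp _ => ?_)
  · have h2 : (2 : ℝ) ≤ p := by exact_mod_cast (Nat.prime_of_mem_primeFactors hp).two_le
    have : 1 / (p : ℝ) ≤ 1 / 2 := one_div_le_one_div_of_le (by norm_num) h2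
    linarith
  · have h2 : (0 : ℝ) < p := by exact_mod_cast (Nat.prime_of_mem_primeFactors hp).pos
    have : 0 ≤ 1 / (p : ℝ) := by positivity
    linarith

/-- The primes `p ≤ m` with `P ≤ p ≤ Q` (`P ≥ 0`) are the primes of `[⌈P⌉, ⌊min(Q, m)⌋]`. [folklore] -/
theorem primesLE_filter_Icc_eq (m : ℕ) {P Q : ℝ} (hP : 0 ≤ P) :
    {p ∈ Nat.primesLE m | P ≤ ((p : ℕ) : ℝ) ∧ ((p : ℕ) : ℝ) ≤ Q} =
      (Icc ⌈P⌉₊ ⌊min Q (m : ℝ)⌋₊).filter Nat.Prime := by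
  ext p
  simp only [Finset.mem_filter, Nat.mem_primesLE, Finset.mem_Icc, Nat.ceil_le]
  constructor
  · rintro ⟨⟨hp1, hp2⟩, hp3, hp4⟩
    have h1 : (p : ℝ) ≤ m := by exact_mod_cast hp1
    have hmin : 0 ≤ min Q (m : ℝ) := le_min (hP.trans (hp3.trans hp4)) (Nat.cast_nonneg _)
    exact ⟨⟨hp3, (Nat.le_floor_iff hmin).mpr (le_min hp4 h1)⟩, hp2⟩
  · rintro ⟨⟨hp1, hp2⟩, hp3⟩
    have hmin : 0 ≤ min Q (m : ℝ) := by
      rcases le_total Q (m : ℝ) with h | h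
      · rw [min_eq_left h]
        by_contra hQ
        push Not at hQ
        rw [min_eq_left h, Nat.floor_of_nonpos hQ.le] at hp2
        have : p = 0 := by omega
        exact absurd (this ▸ hp3) Nat.not_prime_zero
      · rw [min_eq_right h]; exact Nat.cast_nonneg _
    have h' : (p : ℝ) ≤ min Q (m : ℝ) := (Nat.le_floor_iff hmin).mp hp2
    refine ⟨⟨?_, hp3⟩, hp1, h'.trans (min_le_left _ _)⟩
    exact_mod_cast h'.trans (min_le_right _ _)

/-- `#(primesLE n) ≤ n` (the name `card_primesLE_le` is taken by
`Literature.NumberTheory.Sieve.FriedlanderIwaniecPrimes.card_primesLE_le`, bound `X + 1`). [folklore] -/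
theorem card_primesLE_le_self (n : ℕ) : #(Nat.primesLE n) ≤ n := by
  rw [primesLE_eq_filter_Icc]
  exact (Finset.card_filter_le _ _).trans (by simp)

/-! ### The residue classes and the comparison weights -/

/-- The residue classes removed modulo the prime `p`: `0 (mod p)` always, and `-h (mod p)` when
`p ∈ [P, Q]`. [folklore] -/
noncomputable def sieveClasses (P Q : ℝ) (h p : ℕ) : Finset ℕ :=
  if P ≤ (p : ℝ) ∧ (p : ℝ) ≤ Q then {0, (p - h % p) % p} else {0}

/-- The comparison weight `c(p) = 1 - 1/p` if `p ∈ [P, Q]` and `p ∤ h`, else `1`. [folklore] -/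
noncomputable def sieveWeight (P Q : ℝ) (h p : ℕ) : ℝ :=
  if (P ≤ (p : ℝ) ∧ (p : ℝ) ≤ Q) ∧ ¬ p ∣ h then 1 - 1 / (p : ℝ) else 1

/-- The residues are `< p` (for `p > 0`). [folklore] -/
theorem sieveClasses_lt {P Q : ℝ} {h p : ℕ} (hp : 0 < p) : ∀ r ∈ sieveClasses P Q h p, r < p := by
  intro r hr
  unfold sieveClasses at hr
  split_ifs at hr
  · rcases Finset.mem_insert.mp hr with h0 | h0
    · omega
    · rw [Finset.mem_singleton] at h0; rw [h0]; exact Nat.mod_lt _ hp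
  · rw [Finset.mem_singleton] at hr; omega

/-- At most two classes. [folklore] -/
theorem card_sieveClasses_le (P Q : ℝ) (h p : ℕ) : #(sieveClasses P Q h p) ≤ 2 := by
  unfold sieveClasses
  split_ifs
  · exact Finset.card_le_two
  · simp

/-- At least one class. [folklore] -/
theorem one_le_card_sieveClasses (P Q : ℝ) (h p : ℕ) : 1 ≤ #(sieveClasses P Q h p) := by
  unfold sieveClasses
  split_ifs
  · exact Finset.card_pos.mpr ⟨0, by simp⟩
  · simp

/-- At most one class modulo `2` outside the degenerate case. [folklore] -/
theorem card_sieveClasses_two_le {P Q : ℝ} {h : ℕ} (hnd : P ≤ 2 → h % 2 = 0) :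
    #(sieveClasses P Q h 2) ≤ 1 := by
  unfold sieveClasses
  split_ifs with hc
  · have h0 : h % 2 = 0 := hnd (by exact_mod_cast hc.1)
    have : (2 - h % 2) % 2 = 0 := by omega
    rw [this]; simp
  · simp

/-- Membership in the removed classes: `n % q ∈ sieveClasses q ↔ q ∣ n ∨ (q ∈ [P, Q] ∧ q ∣ n + h)`
(`q > 0`). [folklore] -/
theorem mod_mem_sieveClasses_iff {P Q : ℝ} {h q : ℕ} (hq : 0 < q) (n : ℕ) :
    n % q ∈ sieveClasses P Q h q ↔ q ∣ n ∨ ((P ≤ (q : ℝ) ∧ (q : ℝ) ≤ Q) ∧ q ∣ n + h) := by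
  unfold sieveClasses
  rw [Nat.dvd_iff_mod_eq_zero, dvd_add_iff_mod_eq hq]
  split_ifs with hc
  · rw [Finset.mem_insert, Finset.mem_singleton]
    simp only [hc, true_and]
  · rw [Finset.mem_singleton]
    simp only [hc, false_and, or_false]

/-- `0 ≤ c(p) ≤ 1`. [folklore] -/
theorem sieveWeight_nonneg {P Q : ℝ} {h p : ℕ} (hpp : p.Prime) : 0 ≤ sieveWeight P Q h p := by
  unfold sieveWeight; split_ifs
  · have h2 : (2 : ℝ) ≤ p := by exact_mod_cast hpp.two_le
    have : 1 / (p : ℝ) ≤ 1 / 2 := one_div_le_one_div_of_le (by norm_num) h2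
    linarith
  · norm_num

/-- `c(p) ≤ 1`. [folklore] -/
theorem sieveWeight_le_one {P Q : ℝ} {h p : ℕ} : sieveWeight P Q h p ≤ 1 := by
  unfold sieveWeight; split_ifs
  · have : 0 ≤ 1 / (p : ℝ) := by positivity
    linarith
  · exact le_rfl

/-- The local factor of `V(z)` against `(1 - 1/p) c(p)`: `1 - ω(p)/p ≤ (1 - 1/p) c(p)`. [folklore] -/
theorem one_sub_card_div_le {P Q : ℝ} {h p : ℕ} (hpp : p.Prime) :
    1 - (#(sieveClasses P Q h p) : ℝ) / p ≤ (1 - 1 / (p : ℝ)) * sieveWeight P Q h p := by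
  have hp2 : (2 : ℝ) ≤ p := by exact_mod_cast hpp.two_le
  have hp0 : (0 : ℝ) < p := by linarith
  unfold sieveClasses sieveWeight
  by_cases hc : P ≤ (p : ℝ) ∧ (p : ℝ) ≤ Q
  · rw [if_pos hc]
    by_cases hdvd : p ∣ h
    · have h0 : (p - h % p) % p = 0 := by
        rw [Nat.mod_eq_zero_of_dvd hdvd, Nat.sub_zero, Nat.mod_self]
      rw [h0, if_neg (fun h' => h'.2 hdvd)]
      simp
    · have hr0 : (p - h % p) % p ≠ 0 := by
        intro h0
        apply hdvd
        have := (dvd_add_iff_mod_eq hpp.pos 0 h).mpr (by rw [Nat.zero_mod]; exact h0.symm)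
        simpa using this
      rw [if_pos ⟨hc, hdvd⟩, Finset.card_pair (Ne.symm hr0)]
      push_cast
      have key : (1 - 1 / (p : ℝ)) * (1 - 1 / (p : ℝ)) = (1 - 2 / p) + (1 / p) ^ 2 := by ring
      rw [key]
      nlinarith [sq_nonneg (1 / (p : ℝ))]
  · rw [if_neg hc, if_neg (fun h' => hc h'.1)]
    simp

/-- Nonnegativity of the local factor (`ω(2) ≤ 1`, `ω(p) ≤ 2 < p` otherwise). [folklore] -/
theorem one_sub_card_div_nonneg {P Q : ℝ} {h p : ℕ} (hpp : p.Prime)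
    (h2 : #(sieveClasses P Q h 2) ≤ 1) :
    0 ≤ 1 - (#(sieveClasses P Q h p) : ℝ) / p := by
  rw [sub_nonneg, div_le_one (by exact_mod_cast hpp.pos)]
  by_cases hp2 : p = 2
  · subst hp2; exact_mod_cast h2.trans (by norm_num)
  · have h3 : 3 ≤ p := by have := hpp.two_le; omega
    exact_mod_cast (card_sieveClasses_le P Q h p).trans (by omega)

/-- The density at a prime is `< 1`: `ω(p)/p ≤ 2/3` for `p ≥ 3`, `= 1/2` for `p = 2` outside the
degenerate case. [folklore] -/
theorem card_div_lt_one {P Q : ℝ} {h p : ℕ} (hpp : p.Prime)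
    (h2 : #(sieveClasses P Q h 2) ≤ 1) :
    (#(sieveClasses P Q h p) : ℝ) / p < 1 := by
  rw [div_lt_one (by exact_mod_cast hpp.pos)]
  by_cases hp2 : p = 2
  · subst hp2; exact_mod_cast lt_of_le_of_lt h2 (by norm_num)
  · have h3 : 3 ≤ p := by have := hpp.two_le; omega
    exact_mod_cast lt_of_le_of_lt (card_sieveClasses_le P Q h p) (by omega)

/-- Mertens over all primes `p ≤ m`: `∏_{p ≤ m} (1 - 1/p) ≤ e^{6/log 2} log 2 / log m` (`m ≥ 2`).
[folklore] -/
theorem prod_primesLE_one_sub_inv_le {m : ℕ} (hm : 2 ≤ m) :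
    ∏ p ∈ Nat.primesLE m, (1 - 1 / (p : ℝ)) ≤
      Real.exp (6 / Real.log 2) * (Real.log 2 / Real.log m) := by
  have hm2 : (2 : ℝ) ≤ m := by exact_mod_cast hm
  have hset : Nat.primesLE m = (Icc ⌈(2 : ℝ)⌉₊ ⌊(m : ℝ)⌋₊).filter Nat.Prime := by
    rw [Nat.ceil_ofNat, Nat.floor_natCast, Nat.primesLE_eq_filter_Icc_two]
  have hM := Literature.NumberTheory.LFunctions.MertensBound.prod_one_sub_inv_prime_Icc_le (le_refl (2 : ℝ)) hm2
  rw [← hset] at hM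
  simp_rw [← one_div] at hM
  exact hM

/-- The product of the weights `c(p)` over the primes `p ≤ m`, `P ≤ m`:
`∏_{p ≤ m} c(p) ≤ e^{6/log 2} · (log P/log min(Q, m)) · h/φ(h)`. [folklore] -/
theorem prod_sieveWeight_le {m h : ℕ} {P Q : ℝ} (hh : 1 ≤ h) (hP : 2 ≤ P) (hPQ : P ≤ Q)
    (hPm : P ≤ m) :
    ∏ p ∈ Nat.primesLE m, sieveWeight P Q h p ≤
      Real.exp (6 / Real.log 2) * (Real.log P / Real.log (min Q (m : ℝ))) *
        ((h : ℝ) / Nat.totient h) := by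
  have hl2 : (0.6931471803 : ℝ) < Real.log 2 := Real.log_two_gt_d9
  have hlog2 : 0 < Real.log 2 := by linarith
  have hlogP : 0 < Real.log P := Real.log_pos (by linarith)
  have hlogP2 : Real.log 2 ≤ Real.log P := Real.log_le_log (by norm_num) hP
  have hQ' : P ≤ min Q (m : ℝ) := le_min hPQ hPm
  have hlogQ' : 0 < Real.log (min Q (m : ℝ)) := Real.log_pos (by linarith)
  have ht0 : 0 ≤ (h : ℝ) / Nat.totient h := by positivity
  set PP : Finset ℕ := {p ∈ Nat.primesLE m | P ≤ ((p : ℕ) : ℝ) ∧ ((p : ℕ) : ℝ) ≤ Q} with hPP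
  have hcprod : ∏ p ∈ Nat.primesLE m, sieveWeight P Q h p =
      ∏ p ∈ PP with ¬ p ∣ h, (1 - 1 / (p : ℝ)) := by
    rw [Finset.prod_filter, Finset.prod_filter]
    refine Finset.prod_congr rfl fun p _ => ?_
    unfold sieveWeight
    by_cases h1 : P ≤ (p : ℝ) ∧ (p : ℝ) ≤ Q
    · by_cases h2 : p ∣ h
      · rw [if_neg (fun h' => h'.2 h2), if_pos h1, if_neg (fun h' => h' h2)]
      · rw [if_pos ⟨h1, h2⟩, if_pos h1, if_pos h2]
    · rw [if_neg (fun h' => h1 h'.1), if_neg h1]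
  have hmemPP : ∀ p ∈ PP, p.Prime := fun p hp =>
    (Nat.mem_primesLE.mp (Finset.mem_filter.mp hp).1).2
  have hf0 : ∀ p ∈ PP, 0 ≤ 1 - 1 / (p : ℝ) := fun p hp => by
    have h2 : (2 : ℝ) ≤ p := by exact_mod_cast (hmemPP p hp).two_le
    have : 1 / (p : ℝ) ≤ 1 / 2 := one_div_le_one_div_of_le (by norm_num) h2
    linarith
  have hsplit := Finset.prod_filter_mul_prod_filter_not PP (fun p => p ∣ h)
    (fun p => 1 - 1 / (p : ℝ))
  have hdiv : (Nat.totient h : ℝ) / h ≤ ∏ p ∈ PP with p ∣ h, (1 - 1 / (p : ℝ)) :=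
    totient_div_le_prod (by omega) (fun p hp => by
      rw [Finset.mem_filter] at hp
      exact Nat.mem_primeFactors.mpr ⟨hmemPP p hp.1, hp.2, by omega⟩)
  have hφpos : 0 < (Nat.totient h : ℝ) / h := by
    have : 0 < Nat.totient h := Nat.totient_pos.mpr (by omega)
    positivity
  have hP0 : (0 : ℝ) ≤ P := by linarith
  have hPPM : ∏ p ∈ PP, (1 - 1 / (p : ℝ)) ≤
      Real.exp (6 / Real.log 2) * (Real.log P / Real.log (min Q (m : ℝ))) := by
    have hset : PP = (Icc ⌈P⌉₊ ⌊min Q (m : ℝ)⌋₊).filter Nat.Prime := by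
      rw [hPP]; exact primesLE_filter_Icc_eq m hP0
    have hM := Literature.NumberTheory.LFunctions.MertensBound.prod_one_sub_inv_prime_Icc_le hP hQ'
    rw [← hset] at hM
    simp_rw [← one_div] at hM
    refine hM.trans ?_
    have he : Real.exp (6 / Real.log P) ≤ Real.exp (6 / Real.log 2) :=
      Real.exp_le_exp.mpr (div_le_div_of_nonneg_left (by norm_num) hlog2 hlogP2)
    have hr0 : 0 ≤ Real.log P / Real.log (min Q (m : ℝ)) := div_nonneg hlogP.le hlogQ'.le
    exact mul_le_mul_of_nonneg_right he hr0
  have hW0 : 0 ≤ ∏ p ∈ PP, (1 - 1 / (p : ℝ)) := Finset.prod_nonneg hf0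
  have hB0 : 0 < ∏ p ∈ PP with p ∣ h, (1 - 1 / (p : ℝ)) := hφpos.trans_le hdiv
  rw [hcprod]
  have heq : ∏ p ∈ PP with ¬ p ∣ h, (1 - 1 / (p : ℝ)) =
      (∏ p ∈ PP, (1 - 1 / (p : ℝ))) / ∏ p ∈ PP with p ∣ h, (1 - 1 / (p : ℝ)) := by
    rw [eq_div_iff hB0.ne', mul_comm, hsplit]
  rw [heq]
  calc (∏ p ∈ PP, (1 - 1 / (p : ℝ))) / ∏ p ∈ PP with p ∣ h, (1 - 1 / (p : ℝ))
      ≤ (∏ p ∈ PP, (1 - 1 / (p : ℝ))) / ((Nat.totient h : ℝ) / h) :=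
        div_le_div_of_nonneg_left hW0 hφpos hdiv
    _ = (∏ p ∈ PP, (1 - 1 / (p : ℝ))) * ((h : ℝ) / Nat.totient h) := by
        rw [div_div_eq_mul_div, mul_div_assoc]
    _ ≤ _ := mul_le_mul_of_nonneg_right hPPM ht0

/-- Without the hypothesis `P ≤ m`: `∏_{p ≤ m} c(p) ≤ 1`. [folklore] -/
theorem prod_sieveWeight_le_one {m h : ℕ} {P Q : ℝ} :
    ∏ p ∈ Nat.primesLE m, sieveWeight P Q h p ≤ 1 :=
  Finset.prod_le_one (fun _ hp => sieveWeight_nonneg (Nat.mem_primesLE.mp hp).2)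
    fun _ _ => sieveWeight_le_one

end Literature.NumberTheory.Sieve.Lichtman2020

namespace Literature.NumberTheory.Sieve.Lichtman2020

/-! ### Chinese remainder count with prescribed residue sets -/

/-- For a finite set `S` of primes and residue sets `R p ⊆ [0, p)`, the number of `a < ∏_{p ∈ S} p`
with `a % p ∈ R p` for all `p ∈ S` is `∏_{p ∈ S} #(R p)` (`ZMod (∏ p) ≃ ∏ ZMod p`). [folklore] -/
theorem card_filter_range_prod_eq_prod_card (S : Finset ℕ) (hS : ∀ p ∈ S, p.Prime)
    (R : ℕ → Finset ℕ) (hR : ∀ p ∈ S, ∀ r ∈ R p, r < p) :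
    #{a ∈ range (∏ p ∈ S, p) | ∀ p ∈ S, a % p ∈ R p} = ∏ p ∈ S, #(R p) := by
  classical
  set a : ↥S → ℕ := fun i => (i : ℕ) with ha_def
  have hd : ∏ p ∈ S, p = ∏ i, a i := (Finset.prod_coe_sort S (fun p => p)).symm
  have hcop : Pairwise (Function.onFun Nat.Coprime a) := by
    intro i j hij
    exact (Nat.coprime_primes (hS i i.2) (hS j j.2)).mpr (fun h => hij (Subtype.ext h))
  haveI hne : ∀ i, NeZero (a i) := fun i => ⟨(hS i i.2).ne_zero⟩
  haveI : NeZero (∏ i, a i) := ⟨Finset.prod_ne_zero_iff.mpr fun i _ => (hne i).ne⟩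
  rw [hd]
  set Qp : ZMod (∏ i, a i) → Prop := fun x =>
    ∀ i : ↥S, (ZMod.castHom (Finset.dvd_prod_of_mem a (Finset.mem_univ i)) (ZMod (a i)) x).val ∈
      R (i : ℕ)
    with hQ_def
  have hPQ : ∀ n : ℕ, (∀ p ∈ S, n % p ∈ R p) ↔ Qp (n : ZMod (∏ i, a i)) := by
    intro n
    simp only [hQ_def, map_natCast, ZMod.val_natCast]
    exact ⟨fun h i => h i i.2, fun h p hp => h ⟨p, hp⟩⟩
  rw [BrunTwinPrimes.card_filter_range_eq_card_subtype _ Qp hPQ]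
  have e1 : {x : ZMod (∏ i, a i) // Qp x} ≃
      {y : (∀ i, ZMod (a i)) // ∀ i : ↥S, (y i).val ∈ R (i : ℕ)} :=
    (ZMod.prodEquivPi a hcop).toEquiv.subtypeEquiv (fun x => by
      simp only [hQ_def, RingEquiv.toEquiv_eq_coe, EquivLike.coe_coe, ZMod.prodEquivPi_apply])
  have e2 : {y : (∀ i, ZMod (a i)) // ∀ i : ↥S, (y i).val ∈ R (i : ℕ)} ≃
      (∀ i : ↥S, {t : ZMod (a i) // t.val ∈ R (i : ℕ)}) :=
    Equiv.subtypePiEquivPi (α := ↥S) (β := fun i => ZMod (a i))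
      (p := fun i (t : ZMod (a i)) => t.val ∈ R (i : ℕ))
  rw [Fintype.card_congr (e1.trans e2), Fintype.card_pi]
  have h2 : ∀ i : ↥S, Fintype.card {t : ZMod (a i) // t.val ∈ R (i : ℕ)} = #(R (i : ℕ)) := by
    intro i
    rw [Fintype.card_subtype]
    refine Finset.card_nbij' (fun t => t.val) (fun r => ((r : ℕ) : ZMod (a i))) ?_ ?_ ?_ ?_
    · intro t ht
      have ht' : t ∈ Finset.univ.filter (fun t : ZMod (a i) => t.val ∈ R (i : ℕ)) := ht
      exact (Finset.mem_filter.mp ht').2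
    · intro r hr
      have hr' : r ∈ R (i : ℕ) := hr
      show ((r : ℕ) : ZMod (a i)) ∈ Finset.univ.filter (fun t : ZMod (a i) => t.val ∈ R (i : ℕ))
      rw [Finset.mem_filter, ZMod.val_natCast, Nat.mod_eq_of_lt (hR i i.2 r hr')]
      exact ⟨Finset.mem_univ _, hr'⟩
    · intro t _
      exact ZMod.natCast_zmod_val t
    · intro r hr
      have hr' : r ∈ R (i : ℕ) := hr
      show (((r : ℕ) : ZMod (a i))).val = r
      rw [ZMod.val_natCast, Nat.mod_eq_of_lt (hR i i.2 r hr')]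
  simp only [h2]
  exact Finset.prod_coe_sort S (fun p => #(R p))

/-! ### The encoding `Φ` and the sifted sequence -/

/-- `Φ(n) = n · ∏_{p ∣ n + h, P ≤ p ≤ Q} p`: a prime `q` divides `Φ(n)` iff `q ∣ n` or
(`q ∈ [P, Q]` and `q ∣ n + h`), i.e. iff `n` lies in a removed class modulo `q`; sifting the values
`Φ(n)` by the primes `< z` therefore removes two classes modulo the primes of `[P, Q]` and one class
modulo the others. [folklore] -/
noncomputable def encode (P Q : ℝ) (h n : ℕ) : ℕ :=
  n * ∏ p ∈ (n + h).primeFactors with (P ≤ ((p : ℕ) : ℝ) ∧ ((p : ℕ) : ℝ) ≤ Q), p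

/-- A prime `q` divides `Φ(n)` iff `q ∣ n` or (`q ∈ [P, Q]` and `q ∣ n + h`) (`n + h ≠ 0`). [folklore] -/
theorem prime_dvd_encode_iff {P Q : ℝ} {h q : ℕ} (hq : q.Prime) {n : ℕ} (hn : n + h ≠ 0) :
    q ∣ encode P Q h n ↔ q ∣ n ∨ ((P ≤ (q : ℝ) ∧ (q : ℝ) ≤ Q) ∧ q ∣ n + h) := by
  unfold encode
  rw [hq.dvd_mul, Prime.dvd_finsetProd_iff hq.prime]
  apply or_congr_right
  constructor
  · rintro ⟨p, hp, hqp⟩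
    rw [Finset.mem_filter, Nat.mem_primeFactors] at hp
    have := (Nat.prime_dvd_prime_iff_eq hq hp.1.1).mp hqp
    subst this
    exact ⟨hp.2, hp.1.2.1⟩
  · rintro ⟨hc, hdvd⟩
    exact ⟨q, Finset.mem_filter.mpr ⟨Nat.mem_primeFactors.mpr ⟨hq, hdvd, hn⟩, hc⟩, dvd_rfl⟩

/-- The same, as membership of `n % q` in the removed classes. [folklore] -/
theorem prime_dvd_encode_iff_mod_mem {P Q : ℝ} {h q : ℕ} (hq : q.Prime) {n : ℕ} (hn : n + h ≠ 0) :
    q ∣ encode P Q h n ↔ n % q ∈ sieveClasses P Q h q := by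
  rw [prime_dvd_encode_iff hq hn, mod_mem_sieveClasses_iff hq.pos]

/-- `Φ(n) > 0` for `n > 0`. [folklore] -/
theorem encode_pos {P Q : ℝ} {h n : ℕ} (hn : 0 < n) : 0 < encode P Q h n :=
  Nat.mul_pos hn (Finset.prod_pos fun _ hp =>
    (Nat.prime_of_mem_primeFactors (Finset.mem_filter.mp hp).1).pos)

/-- `Φ(n) ≤ n (n + h)`. [folklore] -/
theorem encode_le {P Q : ℝ} {h n : ℕ} : encode P Q h n ≤ n * (n + h) := by
  unfold encode
  rcases Nat.eq_zero_or_pos (n + h) with h0 | hpos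
  · have : n = 0 := by omega
    subst this; simp
  · apply Nat.mul_le_mul_left
    apply Nat.le_of_dvd hpos
    exact (Finset.prod_dvd_prod_of_subset _ _ _ (Finset.filter_subset _ _)).trans
      (Nat.prod_primeFactors_dvd (n + h))

/-- For squarefree `d`: `d ∣ Φ(n)` iff `n % q` is a removed class for every prime `q ∣ d`. [folklore] -/
theorem dvd_encode_iff_of_squarefree {P Q : ℝ} {h d : ℕ} (hd : Squarefree d) {n : ℕ}
    (hn : n + h ≠ 0) :
    d ∣ encode P Q h n ↔ ∀ q ∈ d.primeFactors, n % q ∈ sieveClasses P Q h q := by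
  constructor
  · intro hdvd q hq
    exact (prime_dvd_encode_iff_mod_mem (Nat.prime_of_mem_primeFactors hq) hn).mp
      ((Nat.dvd_of_mem_primeFactors hq).trans hdvd)
  · intro H
    rw [← Nat.prod_primeFactors_of_squarefree hd]
    exact Finset.prod_primes_dvd _ (fun q hq => (Nat.prime_of_mem_primeFactors hq).prime)
      (fun q hq => (prime_dvd_encode_iff_mod_mem (Nat.prime_of_mem_primeFactors hq) hn).mpr (H q hq))

/-- The density `g(d) = ∏_{p ∣ d} ω(p)/p` (`ω(p)` = number of removed classes modulo `p`;
`g(0) = 0`), as a function. [folklore] -/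
noncomputable def densityFn (P Q : ℝ) (h d : ℕ) : ℝ :=
  if d = 0 then 0 else ∏ p ∈ d.primeFactors, ((#(sieveClasses P Q h p) : ℝ) / p)

/-- The density `g` as an arithmetic function. [folklore] -/
noncomputable def density (P Q : ℝ) (h : ℕ) : ArithmeticFunction ℝ :=
  ⟨densityFn P Q h, by simp [densityFn]⟩

/-- `g(d) = ∏_{p ∣ d} ω(p)/p` for `d ≠ 0`. [folklore] -/
theorem density_apply {P Q : ℝ} {h d : ℕ} (hd : d ≠ 0) :
    density P Q h d = ∏ p ∈ d.primeFactors, ((#(sieveClasses P Q h p) : ℝ) / p) := by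
  show densityFn P Q h d = _
  rw [densityFn, if_neg hd]

/-- `g(p) = ω(p)/p` at a prime. [folklore] -/
theorem density_prime {P Q : ℝ} {h p : ℕ} (hp : p.Prime) :
    density P Q h p = (#(sieveClasses P Q h p) : ℝ) / p := by
  rw [density_apply hp.ne_zero, hp.primeFactors, Finset.prod_singleton]

/-- `g` is multiplicative. [folklore] -/
theorem isMultiplicative_density (P Q : ℝ) (h : ℕ) : (density P Q h).IsMultiplicative := by
  refine ⟨?_, ?_⟩
  · rw [density_apply one_ne_zero, Nat.primeFactors_one, Finset.prod_empty]
  · intro m n hmn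
    rcases Nat.eq_zero_or_pos m with rfl | hm
    · simp
    rcases Nat.eq_zero_or_pos n with rfl | hn'
    · simp
    rw [density_apply (Nat.mul_ne_zero hm.ne' hn'.ne'), density_apply hm.ne', density_apply hn'.ne',
      Nat.primeFactors_mul hm.ne' hn'.ne', Finset.prod_union hmn.disjoint_primeFactors]

/-- The sifted sequence of the deduction of (2.5): weights `a_m = #{n ≤ X : Φ(n) = m}`, size `X`,
density `g`. [folklore] -/
noncomputable def seq (X : ℕ) (P Q : ℝ) (h : ℕ) : SieveSequence where
  a m := (#{n ∈ Icc 1 X | encode P Q h n = m} : ℝ)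
  a_nonneg _ := Nat.cast_nonneg _
  size _ := X
  density := density P Q h
  density_mult := isMultiplicative_density P Q h

/-- Unfolding the weights. [folklore] -/
theorem seq_a (X : ℕ) (P Q : ℝ) (h m : ℕ) :
    (seq X P Q h).a m = (#{n ∈ Icc 1 X | encode P Q h n = m} : ℝ) := rfl

/-- Unfolding the size. [folklore] -/
theorem seq_size (X : ℕ) (P Q : ℝ) (h : ℕ) (x : ℝ) : (seq X P Q h).size x = X := rfl

/-- Unfolding the density. [folklore] -/
theorem seq_density (X : ℕ) (P Q : ℝ) (h : ℕ) : (seq X P Q h).density = density P Q h := rfl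

/-- Fibre count: summing the weights over the `m ≤ N` with `C m` counts the `n ≤ X` with `C (Φ n)`,
as soon as `N ≥ X (X + h) ≥ max Φ`. [folklore] -/
theorem sum_a_filter_eq {X : ℕ} {P Q : ℝ} {h N : ℕ} (hN : X * (X + h) ≤ N)
    (C : ℕ → Prop) [DecidablePred C] :
    ∑ m ∈ (Ioc 0 N).filter C, (seq X P Q h).a m = #{n ∈ Icc 1 X | C (encode P Q h n)} := by
  simp only [seq_a]
  rw [← Nat.cast_sum, Nat.cast_inj]
  rw [Finset.card_eq_sum_card_fiberwise (f := encode P Q h) (s := {n ∈ Icc 1 X | C (encode P Q h n)})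
    (t := (Ioc 0 N).filter C) ?_]
  · refine Finset.sum_congr rfl fun m hm => ?_
    have hCm : C m := (Finset.mem_filter.mp hm).2
    congr 1
    ext n
    simp only [Finset.mem_filter]
    constructor
    · rintro ⟨h1, h3⟩
      exact ⟨⟨h1, by rw [h3]; exact hCm⟩, h3⟩
    · rintro ⟨⟨h1, _⟩, h3⟩
      exact ⟨h1, h3⟩
  · intro n hn
    have hn' : n ∈ {n ∈ Icc 1 X | C (encode P Q h n)} := hn
    rw [Finset.mem_filter, Finset.mem_Icc] at hn'
    show encode P Q h n ∈ (Ioc 0 N).filter C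
    rw [Finset.mem_filter, Finset.mem_Ioc]
    refine ⟨⟨encode_pos (by omega), ?_⟩, hn'.2⟩
    exact encode_le.trans (le_trans (Nat.mul_le_mul hn'.1.2 (by omega)) hN)

/-- The congruence sums of the sequence count `n ≤ X` with `d ∣ Φ(n)`. [folklore] -/
theorem seq_congrSum {X : ℕ} {P Q : ℝ} {h N : ℕ} (hN : X * (X + h) ≤ N) (d : ℕ) :
    (seq X P Q h).congrSum d N = #{n ∈ Icc 1 X | d ∣ encode P Q h n} := by
  rw [SieveSequence.congrSum, Nat.floor_natCast]
  exact sum_a_filter_eq hN (d ∣ ·)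

/-- The sifting function of the sequence counts `n ≤ X` with `(Φ(n), P) = 1`. [folklore] -/
theorem seq_sifted {X : ℕ} {P Q : ℝ} {h N : ℕ} (hN : X * (X + h) ≤ N) (Pz : ℕ) :
    (seq X P Q h).sifted N Pz = #{n ∈ Icc 1 X | (encode P Q h n).Coprime Pz} := by
  rw [SieveSequence.sifted, Nat.floor_natCast]
  exact sum_a_filter_eq hN (fun n => n.Coprime Pz)

/-- **Level of distribution of the sequence**: for squarefree `d` (and `h ≥ 1`),
`|R_d| ≤ ω(d) ≤ d`, by periodicity modulo `d` and the Chinese remainder count. [folklore] -/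
theorem abs_remainder_le {X : ℕ} {P Q : ℝ} {h N : ℕ} (hh : 1 ≤ h) (hN : X * (X + h) ≤ N) {d : ℕ}
    (hd : Squarefree d) : |(seq X P Q h).remainder d N| ≤ d := by
  have hd0 : 0 < d := Nat.pos_of_ne_zero hd.ne_zero
  set cond : ℕ → Prop := fun n => ∀ q ∈ d.primeFactors, n % q ∈ sieveClasses P Q h q with hcond
  have hfilter : {n ∈ Icc 1 X | d ∣ encode P Q h n} = {n ∈ Icc 1 X | cond n} := by
    refine Finset.filter_congr fun n hn => ?_
    rw [Finset.mem_Icc] at hn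
    exact dvd_encode_iff_of_squarefree hd (by omega)
  have hper : Function.Periodic cond d := by
    intro n
    simp only [hcond, eq_iff_iff]
    refine forall₂_congr fun q hq => ?_
    obtain ⟨k, hk⟩ := Nat.dvd_of_mem_primeFactors hq
    rw [show (n + d) % q = n % q by rw [hk, Nat.add_mul_mod_self_left]]
  have hcount : Nat.count cond d = ∏ q ∈ d.primeFactors, #(sieveClasses P Q h q) := by
    rw [Nat.count_eq_card_filter_range]
    have := card_filter_range_prod_eq_prod_card d.primeFactors
      (fun q hq => Nat.prime_of_mem_primeFactors hq) (sieveClasses P Q h)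
      (fun q hq => sieveClasses_lt (Nat.prime_of_mem_primeFactors hq).pos)
    rw [Nat.prod_primeFactors_of_squarefree hd] at this
    exact this
  have hcle : Nat.count cond d ≤ d := Nat.count_le _
  have hmain := BrunTwinPrimes.abs_card_filter_Icc_sub_le hd0 cond hper X
  have hdcast : (d : ℝ) = ∏ q ∈ d.primeFactors, (q : ℝ) := by
    rw [← Nat.cast_prod, Nat.prod_primeFactors_of_squarefree hd]
  have hdens : (seq X P Q h).density d * (seq X P Q h).size N =
      (X : ℝ) * (Nat.count cond d : ℝ) / d := by
    rw [seq_density, seq_size, density_apply hd.ne_zero, Finset.prod_div_distrib, ← hdcast, hcount]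
    push_cast
    ring
  rw [SieveSequence.remainder, seq_congrSum hN, hfilter, hdens]
  have hcle' : (Nat.count cond d : ℝ) ≤ d := by exact_mod_cast hcle
  exact hmain.trans hcle'

/-- The shifted primes counted in (2.5) against the sifting function: with `z = m + 1`,
`#{p ≤ X : p + h has no prime factor in [P, Q]} ≤ m + S(𝒜, P(z))`. [folklore] -/
theorem card_filter_primes_le_sifted {X : ℕ} {P Q : ℝ} {h N : ℕ} (hh : 1 ≤ h)
    (hN : X * (X + h) ≤ N) (m : ℕ) :
    (#{p ∈ Nat.primesLE X | ¬ HasPrimeFactorIn P Q (p + h)} : ℝ) ≤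
      m + (seq X P Q h).sifted N (primesProdBelow ((m + 1 : ℕ) : ℝ)) := by
  rw [seq_sifted hN]
  have hsub : {p ∈ Nat.primesLE X | ¬ HasPrimeFactorIn P Q (p + h)} ⊆
      Nat.primesLE m ∪
        {n ∈ Icc 1 X | (encode P Q h n).Coprime (primesProdBelow ((m + 1 : ℕ) : ℝ))} := by
    intro p hp
    rw [Finset.mem_filter, Nat.mem_primesLE] at hp
    obtain ⟨⟨hpX, hpp⟩, hnot⟩ := hp
    rw [Finset.mem_union]
    by_cases hpm : p ≤ m
    · exact Or.inl (Nat.mem_primesLE.mpr ⟨hpm, hpp⟩)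
    right
    rw [Finset.mem_filter, Finset.mem_Icc]
    refine ⟨⟨hpp.one_lt.le, hpX⟩, ?_⟩
    rw [coprime_primesProdBelow_iff]
    intro q hq
    rw [Nat.ceil_natCast, Nat.mem_primesBelow] at hq
    obtain ⟨hqm, hqp⟩ := hq
    rw [prime_dvd_encode_iff hqp (by omega)]
    rintro (h1 | ⟨hc, h2⟩)
    · have := (Nat.prime_dvd_prime_iff_eq hqp hpp).mp h1
      omega
    · exact hnot ⟨q, Nat.mem_primeFactors.mpr ⟨hqp, h2, by omega⟩, hc.1, hc.2⟩
  calc (#{p ∈ Nat.primesLE X | ¬ HasPrimeFactorIn P Q (p + h)} : ℝ)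
      ≤ #(Nat.primesLE m ∪
          {n ∈ Icc 1 X | (encode P Q h n).Coprime (primesProdBelow ((m + 1 : ℕ) : ℝ))}) := by
        exact_mod_cast Finset.card_le_card hsub
    _ ≤ #(Nat.primesLE m) +
          #{n ∈ Icc 1 X | (encode P Q h n).Coprime (primesProdBelow ((m + 1 : ℕ) : ℝ))} := by
        exact_mod_cast Finset.card_union_le _ _
    _ ≤ m + #{n ∈ Icc 1 X | (encode P Q h n).Coprime (primesProdBelow ((m + 1 : ℕ) : ℝ))} :=
        add_le_add (by exact_mod_cast card_primesLE_le_self m) le_rfl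

/-- `V(z)` for the sequence, `z = m + 1`: `V(z) = ∏_{p ≤ m} (1 - ω(p)/p) ≤
(e^{6/log 2} log 2/log m) · ∏_{p ≤ m} c(p)`. [folklore] -/
theorem densityProduct_le {X : ℕ} {P Q : ℝ} {h : ℕ} (hnd : P ≤ 2 → h % 2 = 0) {m : ℕ}
    (hm : 2 ≤ m) :
    (seq X P Q h).densityProduct (primesProdBelow ((m + 1 : ℕ) : ℝ)) ≤
      (Real.exp (6 / Real.log 2) * (Real.log 2 / Real.log m)) *
        ∏ p ∈ Nat.primesLE m, sieveWeight P Q h p := by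
  rw [SieveSequence.densityProduct, primeFactors_primesProdBelow, Nat.ceil_natCast]
  change ∏ p ∈ Nat.primesLE m, (1 - density P Q h p) ≤ _
  calc ∏ p ∈ Nat.primesLE m, (1 - density P Q h p)
      ≤ ∏ p ∈ Nat.primesLE m, ((1 - 1 / (p : ℝ)) * sieveWeight P Q h p) := by
        refine Finset.prod_le_prod (fun p hp => ?_) (fun p hp => ?_)
        · rw [density_prime (Nat.mem_primesLE.mp hp).2]
          exact one_sub_card_div_nonneg (Nat.mem_primesLE.mp hp).2 (card_sieveClasses_two_le hnd)
        · rw [density_prime (Nat.mem_primesLE.mp hp).2]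
          exact one_sub_card_div_le (Nat.mem_primesLE.mp hp).2
    _ = (∏ p ∈ Nat.primesLE m, (1 - 1 / (p : ℝ))) * ∏ p ∈ Nat.primesLE m, sieveWeight P Q h p :=
        Finset.prod_mul_distrib
    _ ≤ _ := mul_le_mul_of_nonneg_right (prod_primesLE_one_sub_inv_le hm)
        (Finset.prod_nonneg fun p hp => sieveWeight_nonneg (Nat.mem_primesLE.mp hp).2)

/-! ### Sieve dimension two -/

/-- The Euler factor with two classes: for real `p ≥ 3`,
`(1 - 2/p)⁻¹ = 1 + 2/(p - 2) ≤ exp(2/p + 8/(p(p-1)))`. [folklore] -/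
theorem inv_one_sub_two_div_le_exp {p : ℝ} (hp : 3 ≤ p) :
    (1 - 2 / p)⁻¹ ≤ Real.exp (2 / p + 8 * (1 / (p * (p - 1)))) := by
  have hp0 : 0 < p := by linarith
  have hp1 : 0 < p - 1 := by linarith
  have hp2 : 0 < p - 2 := by linarith
  have e1 : (1 - 2 / p)⁻¹ = 1 + 2 / (p - 2) := by
    field_simp
    ring
  have e2 : 2 / p + 8 * (1 / (p * (p - 1))) = (2 * (p - 1) + 8) / (p * (p - 1)) := by
    field_simp
  have key : 2 / (p - 2) ≤ (2 * (p - 1) + 8) / (p * (p - 1)) := by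
    rw [div_le_div_iff₀ hp2 (mul_pos hp0 hp1)]
    nlinarith
  rw [e1]
  linarith [key, e2, Real.add_one_le_exp (2 / p + 8 * (1 / (p * (p - 1))))]

/-- **The sequence has sieve dimension `2` with an absolute constant**: outside the degenerate case
(`P ≤ 2` and `h` odd), `0 ≤ g(p) < 1` and
`∏_{w ≤ p < z} (1 - g(p))⁻¹ ≤ 2 e^{17 + 12/log 2} (log z/log w)²` for all `2 ≤ w ≤ z`
(Mertens over the window, twice). [folklore] -/
theorem hasSieveDimension_density {P Q : ℝ} {h : ℕ} (hnd : P ≤ 2 → h % 2 = 0) :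
    HasSieveDimension (density P Q h) 2 (2 * Real.exp (17 + 12 / Real.log 2)) := by
  have hg : ∀ p : ℕ, p.Prime → 0 ≤ density P Q h p ∧ density P Q h p < 1 := fun p hp => by
    rw [density_prime hp]
    exact ⟨by positivity, card_div_lt_one hp (card_sieveClasses_two_le hnd)⟩
  refine ⟨hg, fun w z hw hwz => ?_⟩
  set S := (Nat.primesBelow ⌈z⌉₊).filter (fun p : ℕ => w ≤ (p : ℝ)) with hS
  have hlogw : 0 < Real.log w := Real.log_pos (by linarith)
  have hlogz : 0 < Real.log z := Real.log_pos (by linarith)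
  have hmemS : ∀ p ∈ S, p.Prime ∧ w ≤ (p : ℝ) ∧ p ≤ ⌊z⌋₊ := by
    intro p hp
    rw [hS, Finset.mem_filter, Nat.mem_primesBelow] at hp
    exact ⟨hp.1.2, hp.2, Nat.le_floor (Nat.lt_ceil.mp hp.1.1).le⟩
  have hSle : S ⊆ Nat.primesLE ⌊z⌋₊ := fun p hp =>
    Nat.mem_primesLE.mpr ⟨(hmemS p hp).2.2, (hmemS p hp).1⟩
  set F : ℕ → ℝ := fun p => Real.exp (2 / (p : ℝ) + 8 * (1 / ((p : ℝ) * ((p : ℝ) - 1)))) with hF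
  have hF1 : ∀ p ∈ S, 1 ≤ F p := fun p hp => by
    have hp2 : (2 : ℝ) ≤ p := by exact_mod_cast (hmemS p hp).1.two_le
    have : (0 : ℝ) < (p : ℝ) * ((p : ℝ) - 1) := mul_pos (by linarith) (by linarith)
    exact Real.one_le_exp (by positivity)
  have hpt : ∀ p ∈ S, (1 - density P Q h p)⁻¹ ≤ (if p = 2 then (2 : ℝ) else 1) * F p := by
    intro p hp
    have hpp := (hmemS p hp).1
    rw [density_prime hpp]
    by_cases hp2 : p = 2
    · subst hp2
      rw [if_pos rfl]
      have hc1 : (#(sieveClasses P Q h 2) : ℝ) ≤ 1 := by exact_mod_cast card_sieveClasses_two_le hnd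
      calc (1 - (#(sieveClasses P Q h 2) : ℝ) / (2 : ℕ))⁻¹ ≤ (1 - 1 / 2)⁻¹ := by
            apply inv_anti₀ (by norm_num)
            push_cast
            linarith
        _ = 2 := by norm_num
        _ ≤ 2 * F 2 := le_mul_of_one_le_right (by norm_num) (hF1 2 hp)
    · rw [if_neg hp2, one_mul]
      have hp3 : 3 ≤ p := by have := hpp.two_le; omega
      have hp3' : (3 : ℝ) ≤ p := by exact_mod_cast hp3
      have hc : (#(sieveClasses P Q h p) : ℝ) / p ≤ 2 / p :=
        div_le_div_of_nonneg_right (by exact_mod_cast card_sieveClasses_le P Q h p) (by linarith)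
      have h23 : 2 / (p : ℝ) ≤ 2 / 3 := div_le_div_of_nonneg_left (by norm_num) (by norm_num) hp3'
      calc (1 - (#(sieveClasses P Q h p) : ℝ) / p)⁻¹ ≤ (1 - 2 / (p : ℝ))⁻¹ :=
            inv_anti₀ (by linarith) (by linarith)
        _ ≤ F p := inv_one_sub_two_div_le_exp hp3'
  have hnonneg : ∀ p ∈ S, 0 ≤ (1 - density P Q h p)⁻¹ := fun p hp =>
    inv_nonneg.mpr (sub_nonneg.mpr (hg p (hmemS p hp).1).2.le)
  have hsum1 : ∑ p ∈ S, (1 : ℝ) / p ≤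
      Real.log (Real.log z) - Real.log (Real.log w) + (9 / 2 + 6 / Real.log 2) :=
    sum_primesWindow_one_div_le hw hwz
  have hsum2 : ∑ p ∈ S, (1 : ℝ) / (p * (p - 1)) ≤ 1 :=
    (Finset.sum_le_sum_of_subset_of_nonneg hSle fun p hp _ => by
      have hp2 : (2 : ℝ) ≤ p := by exact_mod_cast (Nat.mem_primesLE.mp hp).2.two_le
      have : (0 : ℝ) < p * (p - 1) := mul_pos (by linarith) (by linarith)
      positivity).trans
      (LFunctions.MertensBound.sum_inv_prime_mul_pred_le_one ⌊z⌋₊)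
  have hprod2 : ∏ p ∈ S, (if p = 2 then (2 : ℝ) else 1) ≤ 2 := by
    have : ∏ p ∈ S, (if p = 2 then (2 : ℝ) else 1) = if 2 ∈ S then 2 else 1 :=
      Finset.prod_ite_eq' S 2 (fun _ => (2 : ℝ))
    rw [this]
    split_ifs <;> norm_num
  have hE : Real.exp (Real.log (Real.log z) - Real.log (Real.log w)) = Real.log z / Real.log w := by
    rw [Real.exp_sub, Real.exp_log hlogz, Real.exp_log hlogw]
  calc ∏ p ∈ S, (1 - density P Q h p)⁻¹
      ≤ ∏ p ∈ S, ((if p = 2 then (2 : ℝ) else 1) * F p) := Finset.prod_le_prod hnonneg hpt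
    _ = (∏ p ∈ S, (if p = 2 then (2 : ℝ) else 1)) * ∏ p ∈ S, F p := Finset.prod_mul_distrib
    _ ≤ 2 * ∏ p ∈ S, F p :=
        mul_le_mul_of_nonneg_right hprod2 (Finset.prod_nonneg fun p _ => (Real.exp_pos _).le)
    _ = 2 * Real.exp (∑ p ∈ S, (2 / (p : ℝ) + 8 * (1 / ((p : ℝ) * ((p : ℝ) - 1))))) := by
        rw [hF, Real.exp_sum]
    _ = 2 * Real.exp (2 * ∑ p ∈ S, 1 / (p : ℝ) + 8 * ∑ p ∈ S, 1 / ((p : ℝ) * ((p : ℝ) - 1))) := by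
        rw [Finset.sum_add_distrib, Finset.mul_sum, Finset.mul_sum]
        congr 3
        refine Finset.sum_congr rfl fun p _ => ?_
        rw [mul_one_div]
    _ ≤ 2 * Real.exp (2 * (Real.log (Real.log z) - Real.log (Real.log w) + (9 / 2 + 6 / Real.log 2))
          + 8 * 1) :=
        mul_le_mul_of_nonneg_left (Real.exp_le_exp.mpr (by linarith)) (by norm_num)
    _ = 2 * Real.exp ((17 + 12 / Real.log 2) +
          ((Real.log (Real.log z) - Real.log (Real.log w)) +
            (Real.log (Real.log z) - Real.log (Real.log w)))) := by
        congr 2; ring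
    _ = 2 * Real.exp (17 + 12 / Real.log 2) * (Real.log z / Real.log w) ^ (2 : ℝ) := by
        rw [Real.exp_add (17 + 12 / Real.log 2),
          Real.exp_add (Real.log (Real.log z) - Real.log (Real.log w)), hE, Real.rpow_two]
        ring

end Literature.NumberTheory.Sieve.Lichtman2020

namespace Literature.NumberTheory.Sieve

open Lichtman2020 in
/-- **The sieve bound (2.5) of Lichtman 2020, PROVED** (discharging the named fact
`Lichtman2020_shiftedPrimeSieveBound`): there is an absolute `C` with
`#{p ≤ X : p + h has no prime factor in [P, Q]} ≤ C π(X) (log P/log Q) (h/φ(h))` for all `X`,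
`h ≥ 1`, `2 ≤ P ≤ Q ≤ X`.  Proof: the upper-bound beta sieve of dimension `2`
(`Literature.NumberTheory.Sieve.SieveSequence.sifted_le_of_dvd_primesProdBelow`, level `D = z^19`, `z = ⌊X^{1/76}⌋ + 1`)
applied to the values `Φ(n) = n ∏_{p ∈ [P,Q], p ∣ n+h} p`, `n ≤ X` (two classes modulo the primes of
`[P, Q]`, one class modulo the others; `|R_d| ≤ d`), followed by Mertens' theorem
(`V(z) ≪ (1/log z)(log P/log min(Q, z)) h/φ(h)`) and Chebyshev's bound `X/log X ≤ 4 π(X)`; the primes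
`p ≤ z` and the level are absorbed by `√X ≪ π(X) log 2/log X`.  As printed the bound is quoted from
"a standard sieve upper bound [Opera]". [cite: Lichtman2020, (2.5)] -/
theorem Lichtman2020_shiftedPrimeSieveBound_holds : Lichtman2020_shiftedPrimeSieveBound := by
  obtain ⟨K, hK⟩ : ∃ K : ℝ, K = 2 * Real.exp (17 + 12 / Real.log 2) := ⟨_, rfl⟩
  obtain ⟨E, hE⟩ : ∃ E : ℝ, E = Real.exp (6 / Real.log 2) := ⟨_, rfl⟩
  obtain ⟨C₁, hC₁⟩ : ∃ C₁ : ℝ, C₁ = 64 / Real.log 2 := ⟨_, rfl⟩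
  obtain ⟨C₂, hC₂⟩ : ∃ C₂ : ℝ, C₂ = 4 * (1 + 2 * K ^ 10) * (152 ^ 2 * E ^ 2) := ⟨_, rfl⟩
  have hl2 : (0.6931471803 : ℝ) < Real.log 2 := Real.log_two_gt_d9
  have hl2' : Real.log 2 < 0.6931471808 := Real.log_two_lt_d9
  have hlog2 : 0 < Real.log 2 := by linarith
  have hK0 : 0 ≤ K := by rw [hK]; positivity
  have hE1 : 1 ≤ E := by rw [hE]; exact Real.one_le_exp (by positivity)
  have hE0 : 0 < E := by linarith
  have hC₁0 : 0 ≤ C₁ := by rw [hC₁]; positivity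
  have hC₂0 : 0 ≤ C₂ := by rw [hC₂]; positivity
  refine ⟨152 + C₁ * (1 + 2 ^ 38) + C₂, fun X h hh P Q hP hPQ hQX => ?_⟩
  -- basic facts
  have hX2 : (2 : ℝ) ≤ X := hP.trans (hPQ.trans hQX)
  have hX0 : (0 : ℝ) < X := by linarith
  have hlogP : 0 < Real.log P := Real.log_pos (by linarith)
  have hlogQ : 0 < Real.log Q := Real.log_pos (by linarith)
  have hlogX : 0 < Real.log X := Real.log_pos (by linarith)
  have hlogPQ : Real.log P ≤ Real.log Q := Real.log_le_log (by linarith) hPQ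
  have hlogQX : Real.log Q ≤ Real.log X := Real.log_le_log (by linarith) hQX
  have hφ0 : (0 : ℝ) < Nat.totient h := by exact_mod_cast Nat.totient_pos.mpr (by omega)
  -- opaque abbreviations `π = π(X)`, `r = log P / log Q`, `w = h / φ(h)`
  obtain ⟨π, hπ⟩ : ∃ π : ℝ, π = Nat.primeCounting X := ⟨_, rfl⟩
  obtain ⟨r, hr⟩ : ∃ r : ℝ, r = Real.log P / Real.log Q := ⟨_, rfl⟩
  obtain ⟨w, hw⟩ : ∃ w : ℝ, w = (h : ℝ) / Nat.totient h := ⟨_, rfl⟩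
  rw [← hπ, ← hr, ← hw]
  have hπ0 : 0 ≤ π := by rw [hπ]; exact Nat.cast_nonneg _
  have hr0 : 0 < r := by rw [hr]; exact div_pos hlogP hlogQ
  have hw1 : 1 ≤ w := by
    rw [hw, le_div_iff₀ hφ0, one_mul]; exact_mod_cast Nat.totient_le h
  have hw0 : 0 < w := by linarith
  have hπrw : 0 ≤ π * r * w := by positivity
  have hTπ : (#{p ∈ Nat.primesLE X | ¬ HasPrimeFactorIn P Q (p + h)} : ℝ) ≤ π := by
    rw [hπ, ← Nat.primesLE_card_eq_primeCounting]
    exact_mod_cast Finset.card_filter_le _ _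
  have hrX : Real.log 2 / Real.log X ≤ r := by
    rw [hr]
    calc Real.log 2 / Real.log X ≤ Real.log P / Real.log X :=
          div_le_div_of_nonneg_right (Real.log_le_log two_pos hP) hlogX.le
      _ ≤ Real.log P / Real.log Q := div_le_div_of_nonneg_left hlogP.le hlogQ hlogQX
  have hrX' : Real.log 2 ≤ r * Real.log X := by rwa [div_le_iff₀ hlogX] at hrX
  -- the final shape
  have hfinal : ∀ T : ℝ, T ≤ C₁ * π * r * w + C₂ * π * r * w + C₁ * 2 ^ 38 * π * r * w →
      T ≤ (152 + C₁ * (1 + 2 ^ 38) + C₂) * π * r * w := fun T hT => by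
    linarith [hπrw]
  -- Case 1: `X` small
  by_cases hXs : Real.log X < 152 * Real.log 2
  · have h152 : 1 ≤ 152 * r := by
      have h2 : r * Real.log X < r * (152 * Real.log 2) := mul_lt_mul_of_pos_left hXs hr0
      have h3 : 1 * Real.log 2 < (152 * r) * Real.log 2 := by linarith
      exact (lt_of_mul_lt_mul_right h3 hlog2.le).le
    have hC : (152 : ℝ) ≤ 152 + C₁ * (1 + 2 ^ 38) + C₂ := by
      have := mul_nonneg hC₁0 (by norm_num : (0 : ℝ) ≤ 1 + 2 ^ 38)
      linarith
    calc (#{p ∈ Nat.primesLE X | ¬ HasPrimeFactorIn P Q (p + h)} : ℝ) ≤ π := hTπ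
      _ ≤ π * (152 * r) := le_mul_of_one_le_right hπ0 h152
      _ ≤ π * (152 * r) * w := le_mul_of_one_le_right (by positivity) hw1
      _ = 152 * (π * r * w) := by ring
      _ ≤ (152 + C₁ * (1 + 2 ^ 38) + C₂) * (π * r * w) := mul_le_mul_of_nonneg_right hC hπrw
      _ = (152 + C₁ * (1 + 2 ^ 38) + C₂) * π * r * w := by ring
  push Not at hXs
  -- `X` large: `X ≥ 2^152`
  have hX4 : (4 : ℝ) ≤ X := by
    have h4 : Real.log 4 ≤ Real.log X := by
      rw [show (4 : ℝ) = 2 ^ 2 by norm_num, Real.log_pow]; push_cast; linarith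
    exact (Real.log_le_log_iff (by norm_num) hX0).mp h4
  have hX4' : 4 ≤ X := by exact_mod_cast hX4
  have hsqrt : Real.sqrt X ≤ C₁ * π * r := by
    have h1 := sqrt_mul_log_le hX4'
    rw [← hπ] at h1
    rw [hC₁, div_mul_eq_mul_div, div_mul_eq_mul_div, le_div_iff₀ hlog2]
    calc Real.sqrt X * Real.log 2 ≤ Real.sqrt X * (r * Real.log X) :=
          mul_le_mul_of_nonneg_left hrX' (Real.sqrt_nonneg _)
      _ = Real.sqrt X * Real.log X * r := by ring
      _ ≤ 64 * π * r := mul_le_mul_of_nonneg_right h1 hr0.le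
  have hsqrtw : Real.sqrt X ≤ C₁ * π * r * w :=
    hsqrt.trans (le_mul_of_one_le_right (by positivity) hw1)
  have h2sqrt : (2 : ℝ) ≤ Real.sqrt X := by
    rw [show (2 : ℝ) = Real.sqrt 4 by
      rw [show (4 : ℝ) = 2 ^ 2 by norm_num, Real.sqrt_sq (by norm_num : (0 : ℝ) ≤ 2)]]
    exact Real.sqrt_le_sqrt hX4
  apply hfinal
  have hrest0 : 0 ≤ C₂ * π * r * w + C₁ * 2 ^ 38 * π * r * w := by
    have := mul_nonneg hC₂0 hπrw
    have := mul_nonneg hC₁0 hπrw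
    linarith
  -- Case 2: the degenerate case `P ≤ 2`, `h` odd: only `p = 2` can be counted
  by_cases hnd : P ≤ 2 → h % 2 = 0
  swap
  · push Not at hnd
    have hsub : {p ∈ Nat.primesLE X | ¬ HasPrimeFactorIn P Q (p + h)} ⊆ {2} := by
      intro p hp
      rw [Finset.mem_filter, Nat.mem_primesLE] at hp
      rw [Finset.mem_singleton]
      by_contra hp2
      rcases hp.1.2.eq_two_or_odd with h2 | hodd
      · exact hp2 h2
      · refine hp.2 ⟨2, Nat.mem_primeFactors.mpr ⟨Nat.prime_two, ?_, by omega⟩, ?_, ?_⟩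
        · have : h % 2 = 1 := by have := hnd.2; omega
          omega
        · exact_mod_cast hnd.1
        · push_cast; linarith
    have hcard : (#{p ∈ Nat.primesLE X | ¬ HasPrimeFactorIn P Q (p + h)} : ℝ) ≤ 1 := by
      exact_mod_cast (Finset.card_le_card hsub).trans (Finset.card_singleton 2).le
    linarith
  -- Case 3: the main case.  Parameters `Y = X^{1/76}`, `m = ⌊Y⌋`, `z = m + 1`, `D = z^19`.
  obtain ⟨Y, hY⟩ : ∃ Y : ℝ, Y = (X : ℝ) ^ ((1 : ℝ) / 76) := ⟨_, rfl⟩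
  have hY0 : 0 < Y := by rw [hY]; positivity
  have hlogY : Real.log Y = Real.log X / 76 := by rw [hY, Real.log_rpow hX0]; ring
  have hY4 : 4 ≤ Y := by
    have : Real.log 4 ≤ Real.log Y := by
      rw [hlogY, show (4 : ℝ) = 2 ^ 2 by norm_num, Real.log_pow]; push_cast; linarith
    exact (Real.log_le_log_iff (by norm_num) hY0).mp this
  have hY1 : 1 ≤ Y := by linarith
  have hYX : Y ≤ Real.sqrt X := by
    rw [hY, Real.sqrt_eq_rpow]
    exact Real.rpow_le_rpow_of_exponent_le (by linarith) (by norm_num)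
  obtain ⟨m, hm⟩ : ∃ m : ℕ, m = ⌊Y⌋₊ := ⟨_, rfl⟩
  have hmY : (m : ℝ) ≤ Y := by rw [hm]; exact Nat.floor_le hY0.le
  have hYm : Y < m + 1 := by rw [hm]; exact Nat.lt_floor_add_one Y
  have hm4 : 4 ≤ m := by rw [hm]; exact Nat.le_floor (by exact_mod_cast hY4)
  have hm2 : 2 ≤ m := by omega
  have hm1 : (1 : ℝ) ≤ m := by exact_mod_cast (by omega : 1 ≤ m)
  have hm0 : (0 : ℝ) < m := by linarith
  have hlogm : Real.log X / 152 ≤ Real.log m := by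
    have h2m : Y / 2 ≤ m := by linarith
    have := Real.log_le_log (by positivity) h2m
    rw [Real.log_div hY0.ne' two_ne_zero, hlogY] at this
    linarith
  have hlogm0 : 0 < Real.log m := lt_of_lt_of_le (by positivity) hlogm
  obtain ⟨z, hz⟩ : ∃ z : ℝ, z = ((m + 1 : ℕ) : ℝ) := ⟨_, rfl⟩
  have hz2 : (2 : ℝ) ≤ z := by rw [hz]; push_cast; linarith
  have hz1 : 1 < z := by linarith
  have hlogz : 0 < Real.log z := Real.log_pos hz1
  have hzY : z ≤ 2 * Y := by rw [hz]; push_cast; linarith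
  have hD1 : (1 : ℝ) < z ^ 19 := one_lt_pow₀ hz1 (by norm_num)
  have hlogD : Real.log (z ^ 19) = 19 * Real.log z := by rw [Real.log_pow]; push_cast; ring
  have hzD : (9 * (2 : ℝ) + 1) * Real.log z ≤ Real.log (z ^ 19) := by rw [hlogD]; norm_num
  -- the sequence and the sieve
  obtain ⟨N, hN⟩ : ∃ N : ℕ, N = X * (X + h) := ⟨_, rfl⟩
  have hNle : X * (X + h) ≤ N := by rw [hN]
  have hdim := hasSieveDimension_density (P := P) (Q := Q) hnd
  rw [← hK] at hdim
  have hsize : 0 ≤ (seq X P Q h).size (N : ℝ) := by rw [seq_size]; exact Nat.cast_nonneg _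
  have hsieve := SieveSequence.sifted_le_of_dvd_primesProdBelow (A := seq X P Q h) hdim
    (by norm_num : (0 : ℝ) < 2) hz2 hD1 hzD hsize (dvd_refl (primesProdBelow z))
  have hexp : Real.exp ((9 * (2 : ℝ) + 1) - Real.log (z ^ 19) / Real.log z) = 1 := by
    rw [hlogD, mul_div_assoc, div_self hlogz.ne', mul_one]; norm_num
  rw [hexp, mul_one, seq_size] at hsieve
  -- the remainder sum: `≤ D · D ≤ 2^38 √X`
  have hrem : ∑ d ∈ (primesProdBelow z).divisors.filter (fun d : ℕ => (d : ℝ) ≤ z ^ 19),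
      |(seq X P Q h).remainder d (N : ℝ)| ≤ z ^ 19 * z ^ 19 := by
    have h1 : ∀ d ∈ (primesProdBelow z).divisors.filter (fun d : ℕ => (d : ℝ) ≤ z ^ 19),
        |(seq X P Q h).remainder d (N : ℝ)| ≤ z ^ 19 := by
      intro d hd
      rw [Finset.mem_filter, Nat.mem_divisors] at hd
      have hsq : Squarefree d := (squarefree_primesProdBelow z).squarefree_of_dvd hd.1.1
      exact (abs_remainder_le hh hNle hsq).trans hd.2
    have h2 : (#((primesProdBelow z).divisors.filter (fun d : ℕ => (d : ℝ) ≤ z ^ 19)) : ℝ) ≤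
        z ^ 19 := by
      have hsub : (primesProdBelow z).divisors.filter (fun d : ℕ => (d : ℝ) ≤ z ^ 19) ⊆
          Icc 1 ⌊z ^ 19⌋₊ := by
        intro d hd
        rw [Finset.mem_filter, Nat.mem_divisors] at hd
        rw [Finset.mem_Icc]
        exact ⟨Nat.pos_of_dvd_of_pos hd.1.1 (Nat.pos_of_ne_zero hd.1.2), Nat.le_floor hd.2⟩
      calc (#((primesProdBelow z).divisors.filter (fun d : ℕ => (d : ℝ) ≤ z ^ 19)) : ℝ)
          ≤ #(Icc 1 ⌊z ^ 19⌋₊) := by exact_mod_cast Finset.card_le_card hsub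
        _ = ((⌊z ^ 19⌋₊ : ℕ) : ℝ) := by rw [Nat.card_Icc, Nat.add_sub_cancel]
        _ ≤ z ^ 19 := Nat.floor_le (by positivity)
    calc ∑ d ∈ (primesProdBelow z).divisors.filter (fun d : ℕ => (d : ℝ) ≤ z ^ 19),
          |(seq X P Q h).remainder d (N : ℝ)|
        ≤ #((primesProdBelow z).divisors.filter (fun d : ℕ => (d : ℝ) ≤ z ^ 19)) • z ^ 19 :=
          Finset.sum_le_card_nsmul _ _ _ h1
      _ = (#((primesProdBelow z).divisors.filter (fun d : ℕ => (d : ℝ) ≤ z ^ 19)) : ℝ) * z ^ 19 := by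
          rw [nsmul_eq_mul]
      _ ≤ z ^ 19 * z ^ 19 := mul_le_mul_of_nonneg_right h2 (by positivity)
  have hDD : z ^ 19 * z ^ 19 ≤ 2 ^ 38 * Real.sqrt X := by
    have h2 : z ^ 38 ≤ (2 * Y) ^ 38 := pow_le_pow_left₀ (by linarith) hzY 38
    have h3 : Y ^ 38 = Real.sqrt X := by
      rw [hY, ← Real.rpow_natCast, ← Real.rpow_mul hX0.le, Real.sqrt_eq_rpow]; norm_num
    calc z ^ 19 * z ^ 19 = z ^ 38 := by ring
      _ ≤ (2 * Y) ^ 38 := h2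
      _ = 2 ^ 38 * Y ^ 38 := by ring
      _ = 2 ^ 38 * Real.sqrt X := by rw [h3]
  -- `V(z)`
  have hV : (seq X P Q h).densityProduct (primesProdBelow z) ≤
      152 ^ 2 * E ^ 2 * r * w / Real.log X := by
    have hV0 := densityProduct_le (X := X) (P := P) (Q := Q) (h := h) hnd hm2
    rw [← hz, ← hE] at hV0
    have hA : E * (Real.log 2 / Real.log m) ≤ 152 * E / Real.log X := by
      have : Real.log 2 / Real.log m ≤ 152 / Real.log X := by
        rw [div_le_div_iff₀ hlogm0 hlogX]
        have h1 : Real.log 2 * Real.log X ≤ 1 * Real.log X :=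
          mul_le_mul_of_nonneg_right (by linarith) hlogX.le
        linarith
      calc E * (Real.log 2 / Real.log m) ≤ E * (152 / Real.log X) :=
            mul_le_mul_of_nonneg_left this (by linarith)
        _ = 152 * E / Real.log X := by ring
    have hB : ∏ p ∈ Nat.primesLE m, sieveWeight P Q h p ≤ 152 * E * r * w := by
      by_cases hPm : P ≤ (m : ℝ)
      · have h1 := prod_sieveWeight_le (m := m) hh hP hPQ hPm
        rw [← hE, ← hw] at h1
        have hmin : Real.log Q / 152 ≤ Real.log (min Q (m : ℝ)) := by
          rcases le_total Q (m : ℝ) with hq | hq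
          · rw [min_eq_left hq]; linarith
          · rw [min_eq_right hq]; linarith
        have hminpos : 0 < Real.log (min Q (m : ℝ)) := lt_of_lt_of_le (by positivity) hmin
        have h2 : Real.log P / Real.log (min Q (m : ℝ)) ≤ 152 * r := by
          rw [div_le_iff₀ hminpos, hr]
          calc Real.log P = 152 * (Real.log P / Real.log Q) * (Real.log Q / 152) := by
                field_simp
            _ ≤ 152 * (Real.log P / Real.log Q) * Real.log (min Q (m : ℝ)) :=
                mul_le_mul_of_nonneg_left hmin (by positivity)
        calc ∏ p ∈ Nat.primesLE m, sieveWeight P Q h p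
            ≤ E * (Real.log P / Real.log (min Q (m : ℝ))) * w := h1
          _ ≤ E * (152 * r) * w := by
              apply mul_le_mul_of_nonneg_right _ hw0.le
              exact mul_le_mul_of_nonneg_left h2 (by linarith)
          _ = 152 * E * r * w := by ring
      · push Not at hPm
        have h2 : 1 ≤ 152 * r := by
          have hlm : Real.log (m : ℝ) ≤ Real.log P := Real.log_le_log hm0 hPm.le
          have : Real.log Q ≤ 152 * Real.log P := by linarith
          rw [hr, mul_div_assoc', le_div_iff₀ hlogQ]
          linarith
        calc ∏ p ∈ Nat.primesLE m, sieveWeight P Q h p ≤ 1 := prod_sieveWeight_le_one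
          _ ≤ 152 * r := h2
          _ ≤ 152 * r * E := le_mul_of_one_le_right (by positivity) hE1
          _ ≤ 152 * r * E * w := le_mul_of_one_le_right (by positivity) hw1
          _ = 152 * E * r * w := by ring
    have hW0 : 0 ≤ ∏ p ∈ Nat.primesLE m, sieveWeight P Q h p :=
      Finset.prod_nonneg fun p hp => sieveWeight_nonneg (Nat.mem_primesLE.mp hp).2
    calc (seq X P Q h).densityProduct (primesProdBelow z)
        ≤ E * (Real.log 2 / Real.log m) * ∏ p ∈ Nat.primesLE m, sieveWeight P Q h p := hV0
      _ ≤ (152 * E / Real.log X) * (152 * E * r * w) :=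
          mul_le_mul hA hB hW0 (div_nonneg (by positivity) hlogX.le)
      _ = 152 ^ 2 * E ^ 2 * r * w / Real.log X := by ring
  -- the main term
  have hcheb : (X : ℝ) / Real.log X ≤ 4 * π := by
    rw [hπ]; exact div_log_le_four_mul_primeCounting hX4'
  have hmainT : (1 + 2 * K ^ 10) * ((X : ℝ) * (seq X P Q h).densityProduct (primesProdBelow z)) ≤
      C₂ * π * r * w := by
    have hK10 : 0 ≤ 1 + 2 * K ^ 10 := by positivity
    calc (1 + 2 * K ^ 10) * ((X : ℝ) * (seq X P Q h).densityProduct (primesProdBelow z))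
        ≤ (1 + 2 * K ^ 10) * ((X : ℝ) * (152 ^ 2 * E ^ 2 * r * w / Real.log X)) :=
          mul_le_mul_of_nonneg_left (mul_le_mul_of_nonneg_left hV hX0.le) hK10
      _ = (1 + 2 * K ^ 10) * (152 ^ 2 * E ^ 2) * (r * w) * ((X : ℝ) / Real.log X) := by ring
      _ ≤ (1 + 2 * K ^ 10) * (152 ^ 2 * E ^ 2) * (r * w) * (4 * π) :=
          mul_le_mul_of_nonneg_left hcheb (by positivity)
      _ = C₂ * π * r * w := by rw [hC₂]; ring
  -- assembly
  have hcount := card_filter_primes_le_sifted (X := X) (P := P) (Q := Q) hh hNle m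
  rw [← hz] at hcount
  have hmle : (m : ℝ) ≤ C₁ * π * r * w := hmY.trans (hYX.trans hsqrtw)
  have hR : ∑ d ∈ (primesProdBelow z).divisors.filter (fun d : ℕ => (d : ℝ) ≤ z ^ 19),
      |(seq X P Q h).remainder d (N : ℝ)| ≤ C₁ * 2 ^ 38 * π * r * w := by
    calc _ ≤ z ^ 19 * z ^ 19 := hrem
      _ ≤ 2 ^ 38 * Real.sqrt X := hDD
      _ ≤ 2 ^ 38 * (C₁ * π * r * w) := mul_le_mul_of_nonneg_left hsqrtw (by norm_num)
      _ = C₁ * 2 ^ 38 * π * r * w := by ring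
  calc (#{p ∈ Nat.primesLE X | ¬ HasPrimeFactorIn P Q (p + h)} : ℝ)
      ≤ m + (seq X P Q h).sifted N (primesProdBelow z) := hcount
    _ ≤ C₁ * π * r * w + (C₂ * π * r * w + C₁ * 2 ^ 38 * π * r * w) :=
        add_le_add hmle (hsieve.trans (add_le_add hmainT hR))
    _ = C₁ * π * r * w + C₂ * π * r * w + C₁ * 2 ^ 38 * π * r * w := by ring

open Lichtman2020 in
/-- **Lichtman 2020, Theorem 1.1 (qualitative part) from Theorem 2.2 alone**: combining the
reduction `lichtman2020_moebius_shifted_primes_avg_of_keyFourierEstimate` (file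
`MoebiusShiftedPrimesProofs`) with the proved sieve bound (2.5). [cite: Lichtman2020, Theorem 1.1] -/
theorem lichtman2020_moebius_shifted_primes_avg_of_keyFourierEstimate'
    (h22 : Lichtman2020_keyFourierEstimate) : lichtman2020_moebius_shifted_primes_avg :=
  lichtman2020_moebius_shifted_primes_avg_of_keyFourierEstimate h22
    Lichtman2020_shiftedPrimeSieveBound_holds

end Literature.NumberTheory.Sieve
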